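import Summits.BirchSwinnertonDyer.Rank1Residual.GaloisImage.SakamotoRankOneAtOne
import Summits.BirchSwinnertonDyer.Rank1Residual.GaloisImage.KolyvaginStubVanishingForms
import Literature.NumberTheory.GaloisRepresentations.ContinuousH1OrderTwo
import Literature.NumberTheory.GaloisRepresentations.TateDualityCounting
import Literature.NumberTheory.GaloisCohomology.Sakamoto2024KolyvaginFittingIdealAt
import HarnessLib

/-!
# [S24] Thm. 4.4 (2) for `R = 𝔽₃`, `K = ℚ` — the `m = 1` slice of the pinned fact
# `Sakamoto2024.kolyvaginSystems_idealOfBasis_eq_fittingIdeal_zmod_three_pow`, PROVED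
# (cell `b2b-bsdres`, team n1011, ROUTE-1 item R1-56, row T-R1-56-S2 "S24(2) @ m = 1 in the kernel";
# seat p13; inputs: row T-R1-56-S FILE E′/F (p13, p11, p16, p15), row T-R1-56-K6 (p09))

HONEST FRAMING (verbatim for the cell): research route; prove what is provable now; no claim beyond
stated classes; nothing booked; no mark / label moved.  TOOL theorems.  ONE slice theorem: the
named-fact slice
`Literature.NumberTheory.GaloisCohomology.Sakamoto2024.kolyvaginSystems_idealOfBasis_eq_fittingIdeal_zmod_three_pow_at 1`
([S24] Thm. 4.4 (2) for `R = ℤ/3`, `K = ℚ`, unfolded to cardinalities: for a generator `κ` of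
`KS₁(T/3T, 𝓕, 𝒫)` and a level `d`, `#N_d ∣ 3 ⟹ ord(κ_d) · #N_d = 3` and `3 ∣ #N_d ⟹ κ_d = 0`,
`N_d = H¹_{𝓕(d)^*}(ℚ, T̄^∨(1))` for ANY Poitou–Tate family `inv'` at the level `3 = 3^1`) is a
THEOREM of the tree.  It does NOT prove the pinned `∀ m` fact (levels `m ≥ 2` need Mazur–Rubin's
principal-artinian theory, [MR04] §4.5, not held), and retires none of the (a′)/E2 debt of the deep
rows, which instantiate the fact at depth `k′ ≥ 1`.

## Proof

At `m = 1` the statement says: `κ_d ≠ 0` iff `d` is a core vertex (`N_d = 0`).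
* §A (generic, any number field `K`, any `n`): the dual local condition `𝓛_v^*` — hence the dual
  Selmer structure and the dual Selmer group — does NOT depend on the family of local invariant
  maps among families injective on `H²(K_v, μ_n)` at the finite places (`inv_v (a ∪ b) = 0 ↔ a ∪ b = 0`),
  provided `n` is odd (at an infinite place `H¹(K_w, M^∨(1))` is killed by `2` and by `n`, so it
  vanishes and every local condition there is the whole group).  So `N_d(inv') = N_d(inv)`.
* §B core vertex `d` (`N_d = 0`): `KS₁ ≅ ℤ/3` (row T-R1-56-S FILE E′,
  `CoreRankOne.isFreeRankOneZMod_and_bijective_of_coreRankOne`, clause 1), so a generator `κ` is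
  non-zero, and `κ ↦ κ_d` is injective at `d` (clause 2), so `κ_d ≠ 0`, `ord(κ_d) = 3`, `#N_d = 1`.
* §B non-core vertex `d` (`N_d ≠ 0`): `κ_d = 0` by stub vanishing at `m = 1` (Mazur–Rubin Thm. 4.3.4 /
  Rubin PCMI Thm. 2.8.4; row T-R1-56-K6, p09's
  `CoreRankZero.dualSelmerGroup_atLevel_eq_bot_of_apply_ne_zero_of_selfDual`, prime choice =
  Sakamoto Cor. 5.5 = p15's `PrimeChoice.…_three`); then `ord(κ_d) = 1` and, if `#N_d ∣ 3`,
  `#N_d = 3`.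
The binders of the slice are discharged exactly as in FILE F (`SakamotoRankOneAtOne.lean`): F-fin,
p16's transports along `red` (`incl ∘ red = id` at `m = 1`), the local shapes at Sakamoto's primes,
p11's `hTθ`, admissibility of the canonical comparison maps, p15's Chebotarev prime choices.

Hypothesis ledger (slice binders at `m = 1`): used — all but `𝓕.IsCartesian` (vacuous at `m = 1`,
Rubin Rem. 2.4.1), the kernel description of `red` (implied by `incl ∘ red = id`), `∞ ∈ S`, and the
three global properties of `inv'` (`SumLocalTermEqZero`, `UnramifiedOrthogonal`, `SelmerComplement`:
only `inv'.IsPerfect` — injectivity of `inv'_v` at finite `v` — enters, through §A).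

References: R. Sakamoto, JTNB 36 (2024) Def. 4.2, Rem. 4.3, Thm. 4.4 (2) (p. 926), Prop. 7.7 (p. 936),
Cor. 5.5 (p. 929); K. Rubin, PCMI 18 (2011) Thm. 2.8.4, Cor. 2.8.9, Prop. 2.9.3; B. Mazur, K. Rubin,
Mem. AMS 799 (2004) Thm. 4.3.4, Cor. 4.5.2 (not held); J. S. Milne, *Arithmetic Duality Theorems*
(2006) I Thm. 2.13 (archimedean local duality), I Cor. 2.3.
-/

noncomputable section

open scoped Classical NumberField ContRepresentation
open Function NumberField IsDedekindDomain
open Literature.NumberTheory.GaloisRepresentations Literature.NumberTheory.GaloisRepresentations.DiscreteGaloisModule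
  Literature.NumberTheory.GaloisCohomology
open Summit.BirchSwinnertonDyer.Rank1Residual.GaloisImage.Transport
open Summit.BirchSwinnertonDyer.Rank1Residual.X11b.Levels

universe u

/-! ## §A. The dual Selmer structure does not depend on the family of local invariant maps -/

namespace Summit.BirchSwinnertonDyer.Rank1Residual.GaloisImage.DualFamily

variable {K : Type u} [Field K] [NumberField K]
variable {M : Type u} [AddCommGroup M] [TopologicalSpace M] [DiscreteTopology M] [Finite M]

/-- **The dual local condition does not depend on the invariant map, among injective ones.**  For two
families `inv₁`, `inv₂` of local invariant maps both injective on `H²(K_v, μ_n)` at the place `v`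
(for the class-field-theoretic family and any family differing from it by units: `inv_v` is an
isomorphism `H²(K_v, μ_n) ⥲ ℤ/n`, Milne I Cor. 2.3 / Harari Prop. 8.13), the annihilators of a local
condition `𝓛_v ≤ H¹(K_v, M)` under `(a, b) ↦ inv₁,v (a ∪ b)` and under `(a, b) ↦ inv₂,v (a ∪ b)`
coincide: both are `{b | a ∪ b = 0 ∀ a ∈ 𝓛_v}`. [folklore] -/
theorem dualLocalCondition_eq_of_injective {n : ℕ} (inv₁ inv₂ : LocalInvariants K n)
    (ρ : DiscreteGaloisModule K M) (v : Place K)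
    (h₁ : Injective (inv₁ v)) (h₂ : Injective (inv₂ v))
    (L : AddSubgroup (galoisCohomology (ρ.toLocal v) 1)) :
    inv₁.dualLocalCondition ρ v L = inv₂.dualLocalCondition ρ v L := by
  ext b
  simp only [LocalInvariants.mem_dualLocalCondition_iff, localTatePairingZMod_apply,
    map_eq_zero_iff _ h₁, map_eq_zero_iff _ h₂]

/-- **At an infinite place and odd `n`, `H¹(K_w, M^∨(1)) = 0`** (`M^∨(1) = Hom(M, μ_n)` is killed by
`n`, and `H¹` of a group of order `≤ 2` is killed by `2`): every class vanishes.  Milne, *ADT* I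
Thm. 2.13 setting; the tree's `eq_zero_of_odd_nsmul_eq_zero_infinitePlace`. [folklore] -/
theorem galoisCohomology_one_tateDual_inl_eq_zero {n : ℕ} (hn : Odd n) (ρ : DiscreteGaloisModule K M)
    (w : InfinitePlace K) (y : galoisCohomology ((ρ.tateDual n).toLocal (Sum.inl w)) 1) : y = 0 :=
  eq_zero_of_odd_nsmul_eq_zero_infinitePlace w _ hn y
    (nsmul_continuousCohomology_one_eq_zero _ n
      (fun f : TateDual K M n => DiscreteGaloisModule.TateDual.nsmul_eq_zero f) y)

/-- **At an infinite place and odd `n` every dual local condition is the whole (zero) group**, for any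
family of local invariant maps. [folklore] -/
theorem dualLocalCondition_inl_eq_top {n : ℕ} (hn : Odd n) (inv : LocalInvariants K n)
    (ρ : DiscreteGaloisModule K M) (w : InfinitePlace K)
    (L : AddSubgroup (galoisCohomology (ρ.toLocal (Sum.inl w)) 1)) :
    inv.dualLocalCondition ρ (Sum.inl w) L = ⊤ := by
  rw [eq_top_iff]
  intro b _
  rw [galoisCohomology_one_tateDual_inl_eq_zero hn ρ w b]
  exact zero_mem _

/-- **The dual Selmer structure `𝓛^*` does not depend on the Poitou–Tate family**, among families
injective on `H²(K_v, μ_n)` at every finite place, when `n` is odd: place by place the dual local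
conditions coincide (finite places: `dualLocalCondition_eq_of_injective`; infinite places: both are
the zero group, `dualLocalCondition_inl_eq_top`).  In print there is ONE family (the invariant maps
of class field theory); the tree quantifies over families (`LocalInvariants`), and this lemma says the
quantification is harmless for `𝓛^*` — two perfect families give the same `H¹_{𝓛^*}(K, M^∨(1))`.
[folklore] -/
theorem dualSelmerStructure_eq_of_injective_of_odd {n : ℕ} (hn : Odd n)
    (inv₁ inv₂ : LocalInvariants K n) (ρ : DiscreteGaloisModule K M)
    (h₁ : ∀ v : HeightOneSpectrum (𝓞 K), Injective (inv₁ (Sum.inr v)))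
    (h₂ : ∀ v : HeightOneSpectrum (𝓞 K), Injective (inv₂ (Sum.inr v)))
    (𝓛 : SelmerStructure ρ) :
    inv₁.dualSelmerStructure ρ 𝓛 = inv₂.dualSelmerStructure ρ 𝓛 := by
  funext v
  rw [LocalInvariants.dualSelmerStructure_apply, LocalInvariants.dualSelmerStructure_apply]
  rcases v with w | v
  · rw [dualLocalCondition_inl_eq_top hn inv₁ ρ w, dualLocalCondition_inl_eq_top hn inv₂ ρ w]
  · exact dualLocalCondition_eq_of_injective inv₁ inv₂ ρ (Sum.inr v) (h₁ v) (h₂ v) (𝓛 (Sum.inr v))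

/-- Hence **the dual Selmer group `H¹_{𝓛^*}(K, M^∨(1))` does not depend on the Poitou–Tate family**
(families injective at the finite places, `n` odd). [folklore] -/
theorem dualSelmerGroup_eq_of_injective_of_odd {n : ℕ} (hn : Odd n)
    (inv₁ inv₂ : LocalInvariants K n) (ρ : DiscreteGaloisModule K M)
    (h₁ : ∀ v : HeightOneSpectrum (𝓞 K), Injective (inv₁ (Sum.inr v)))
    (h₂ : ∀ v : HeightOneSpectrum (𝓞 K), Injective (inv₂ (Sum.inr v)))
    (𝓛 : SelmerStructure ρ) :
    (inv₁.dualSelmerStructure ρ 𝓛).selmerGroup = (inv₂.dualSelmerStructure ρ 𝓛).selmerGroup := by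
  rw [dualSelmerStructure_eq_of_injective_of_odd hn inv₁ inv₂ ρ h₁ h₂ 𝓛]

end Summit.BirchSwinnertonDyer.Rank1Residual.GaloisImage.DualFamily

/-! ## §B. The slice at `m = 1` -/

namespace Summit.BirchSwinnertonDyer.Rank1Residual.GaloisImage

open Summit.BirchSwinnertonDyer.Rank1Residual.GaloisImage.CoreRankZero

/-- **[S24] Thm. 4.4 (2) at `m = 1` (`R = 𝔽₃`, `K = ℚ`) is a theorem**: the slice
`Sakamoto2024.kolyvaginSystems_idealOfBasis_eq_fittingIdeal_zmod_three_pow_at 1` of the pinned fact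
holds — for `(T, 𝓕, 𝒫)` over `ℚ` with (H.0)–(H.3), (H.SD), `χ(𝓕) = 1`, `𝓕` cartesian and residually
coisotropic on `S(𝓕)`, Sakamoto's primes and the canonical finite–singular comparison maps, a
GENERATOR `κ` of `KS₁(T/3T, 𝓕, 𝒫)` and a level `d`, with `N_d = H¹_{𝓕(d)^*}(ℚ, T̄^∨(1))` the dual
Selmer group of `𝓕(d)` for any Poitou–Tate family `inv'` at the level `3`:
`#N_d ∣ 3 ⟹ ord(κ_d) · #N_d = 3` and `3 ∣ #N_d ⟹ κ_d = 0` ("`I_R(κ_d) = Fitt⁰_R(N_d^∨)`" for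
`R = 𝔽₃`: `κ_d ≠ 0` exactly at the core vertices).  Core vertices: freeness + injectivity of
`κ ↦ κ_d` (FILE E′); other vertices: stub vanishing (row K6); `N_d(inv') = N_d(inv)` (§A).
[cite: Sakamoto2024, Thm. 4.4 (2) (p. 926; = Prop. 7.7, p. 936) with Def. 4.2 and Rem. 4.3]
[cite: Rubin2011, Thm. 2.8.4 (p. 25) and Cor. 2.8.9 (2) (p. 25)] -/
theorem kolyvaginSystems_idealOfBasis_eq_fittingIdeal_zmod_three_pow_at_one :
    Sakamoto2024.kolyvaginSystems_idealOfBasis_eq_fittingIdeal_zmod_three_pow_at 1 := by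
  intro M _ _ _ _ Mbar _ _ _ _ _ _ _ ρ ρbar red incl τ θ inv S 𝓕 D η hred _hker hincl hirr hτμ hτq hH3
    hθ hperf hsum hur hcompl _hinf hS h𝓕 _hcart hχ hcois hP hT hD inv' hperf' _hsum' _hur' _hcompl'
    κ hgen d hd
  haveI : Fact (Nat.Prime 3) := ⟨Nat.prime_three⟩
  haveI : Fact (Nat.Prime (3 ^ 1)) := ⟨by norm_num⟩
  haveI : NeZero ((3 : ℕ) ^ 1) := ⟨by norm_num⟩
  -- `3 · M = 0`
  have hMN : ∀ m : M, (3 ^ 1 : ℕ) • m = 0 := fun m => ZModModule.char_nsmul_eq_zero (3 ^ 1) m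
  have hM : ∀ m : M, (3 : ℕ) • m = 0 := fun m => by simpa using hMN m
  -- `red` / `incl` are inverse bijections at `m = 1`
  have hee' : ∀ a : M, incl (red a) = a := fun a => by rw [hincl a]; simp
  have he'e : ∀ b : Mbar, red (incl b) = b := fun b => by
    obtain ⟨a, rfl⟩ := hred b
    rw [hee']
  -- the residual self-duality transported to `M`
  set θ' := inverseOfBijective θ hθ with hθ'def
  have hθθ' : ∀ b, θ' (θ b) = b := inverseOfBijective_apply θ hθ
  have hθ'θ : ∀ g, θ (θ' g) = g := fun g => by
    obtain ⟨b, rfl⟩ := hθ.2 g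
    rw [hθθ']
  have hΘΘ' := transportedSelfDual_left_inv red incl θ θ' hee' he'e hθθ'
  have hΘ'Θ := transportedSelfDual_right_inv red incl θ θ' hee' he'e hθ'θ
  have hΘ'inj : Injective (galoisCohomology.map (incl.comp (θ'.comp (tateDualComap incl))) 1) :=
    map_injective_of_comp_eq _ _ hΘ'Θ
  -- finiteness of the Selmer group (F-fin) and of the dual Selmer group (core-rank count)
  have hfin : Finite 𝓕.selmerGroup :=
    SelmerFinite.finite_selmerGroup_of_isUnramifiedOutside ρ (fun v hv => (hS v hv).2) h𝓕
  have hχM : LocalInvariants.HasCoreRank inv 𝓕 3 1 :=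
    (hasCoreRank_induced_iff_comap red incl inv 𝓕 hee' he'e 3 1).mp hχ
  have hfind : Finite (inv.dualSelmerStructure ρ 𝓕).selmerGroup := by
    have h := hχM
    rw [LocalInvariants.HasCoreRank, pow_one] at h
    refine Nat.finite_of_card_ne_zero fun h0 => ?_
    have h' : Nat.card 𝓕.selmerGroup = 0 := by rw [h, h0, mul_zero]
    exact Nat.card_pos.ne' h'
  have hcoisM := isResiduallyCoisotropic_of_induced_comap red incl inv 𝓕 hee' θ hcois
  -- the Kolyvagin primes
  set S₀ : Set (HeightOneSpectrum (𝓞 ℚ)) := {v | (Sum.inr v : Place ℚ) ∈ S} with hS₀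
  have hS₀fin : S₀.Finite := (S.finite_toSet.preimage Sum.inr_injective.injOn).subset fun v hv => hv
  have hPS : ∀ q ∈ D.primes, (Sum.inr q : Place ℚ) ∉ S := fun q hq => by
    rw [hP] at hq
    exact hq.1
  have hτq3 : Nonempty (cokerSubOne ρ τ ≃+ ZMod 3) := by simpa using hτq
  have hU : ∀ q ∈ D.primes, Nat.card (unramifiedSubgroup (GaloisRep.toLocal q ρ) 1) = 3 :=
    fun q hq => (natCard_unramifiedSubgroup_toLocal_of_primes_eq ρ hP hτq q hq).trans (pow_one 3)
  have hTr : ∀ q ∈ D.primes, Nat.card (D.transverse (Sum.inr q)) = 3 :=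
    fun q hq => (natCard_transverse_rat_of_primes_eq_of_smul_eq_zero' ρ hP hT hτq hτμ hMN q hq).trans
      (pow_one 3)
  have hUT := unramifiedSubgroup_sup_transverse_eq_top_rat_of_primes_eq_of_smul_eq_zero' ρ hP hT hτμ hMN
  have hTθ := CoreRankOne.comap_dualLocalCondition_transverse_eq_rat
    ((tateDualComap red).comp (θ.comp red)) (incl.comp (θ'.comp (tateDualComap incl))) (by decide : Odd 3)
    hperf hur hM hΘΘ' hS hPS hP hT hτμ hMN
  have hadm : D.IsAdmissible :=
    FSComp.isAdmissible_of_hasCanonicalComparison_frobeniusClassPrimes ρ (3 ^ 1) S₀ hτq hτμ hP hD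
  -- the prime choices on `M` (Chebotarev, T-C55K), through (H.1) and (H.3) transported to `M`
  have hirrM := irreducible_of_equiv red incl hee' hirr
  have hH3M := h3_of_equiv red incl hee' (3 ^ 1) hH3
  have hirrM' : ∀ A : AddSubgroup M,
      (∀ (s : Field.absoluteGaloisGroup ℚ), ∀ m ∈ A, ρ s m ∈ A) → A = ⊥ ∨ A = ⊤ :=
    fun A hA => hirrM A fun s m hm => hA s m hm
  have hch3 : ∀ c₁ c₂ c₃ : galoisCohomology ρ 1, c₁ ≠ 0 → c₂ ≠ 0 → c₃ ≠ 0 →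
      {q ∈ D.primes | galoisCohomology.localization ρ (Sum.inr q) 1 c₁ ≠ 0 ∧
        galoisCohomology.localization ρ (Sum.inr q) 1 c₂ ≠ 0 ∧
        galoisCohomology.localization ρ (Sum.inr q) 1 c₃ ≠ 0}.Infinite := by
    rw [hP]
    exact PrimeChoice.infinite_setOf_mem_frobeniusClassPrimes_localization_ne_zero_three ρ le_rfl
      (by norm_num) S₀ hS₀fin hτq3 hirrM' hH3M
  have hL52 : ∀ c₁ c₂ c₃ c₄ : galoisCohomology ρ 1,
      (∀ a : Fin 3 → ZMod 3, (∑ i, (a i).val • ![c₁, c₂, c₃] i) = 0 → a = 0) → c₄ ≠ 0 →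
      {q ∈ D.primes | galoisCohomology.localization ρ (Sum.inr q) 1 c₁ ≠ 0 ∧
        galoisCohomology.localization ρ (Sum.inr q) 1 c₂ ≠ 0 ∧
        galoisCohomology.localization ρ (Sum.inr q) 1 c₃ ≠ 0 ∧
        galoisCohomology.localization ρ (Sum.inr q) 1 c₄ ≠ 0}.Infinite := by
    intro c₁ c₂ c₃ c₄ hind hc₄
    rw [hP]
    exact PrimeChoice.infinite_setOf_mem_frobeniusClassPrimes_localization_ne_zero_four ρ le_rfl (by norm_num)
      S₀ hS₀fin hτq3 hirrM' hH3M c₁ c₂ c₃ c₄ hind hc₄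
  -- the single-module structure theorem (FILE E′): freeness and bijectivity at the core vertices
  have main := CoreRankOne.isFreeRankOneZMod_and_bijective_of_coreRankOne hperf hsum hcompl hur hM hS h𝓕
    hfin hfind _ _ hΘΘ' hΘ'Θ hcoisM hχM hPS hU hTr hUT hTθ hch3 hL52 hadm
  -- read the level `3 ^ 1` of the second family as `3`
  change (Nat.card (LocalInvariants.dualSelmerStructure (n := 3) inv' ρ (D.atLevel 𝓕 d)).selmerGroup ∣ 3 →
      addOrderOf (κ.1 d) *
        Nat.card (LocalInvariants.dualSelmerStructure (n := 3) inv' ρ (D.atLevel 𝓕 d)).selmerGroup = 3) ∧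
    (3 ∣ Nat.card (LocalInvariants.dualSelmerStructure (n := 3) inv' ρ (D.atLevel 𝓕 d)).selmerGroup →
      κ.1 d = 0)
  -- §A: the dual Selmer group of `𝓕(d)` is the same for `inv'` and for `inv`
  rw [DualFamily.dualSelmerGroup_eq_of_injective_of_odd (n := 3) (by decide : Odd 3) inv' inv ρ
    (fun v => (hperf' v).1.injective) (fun v => (hperf v).1.injective) (D.atLevel 𝓕 d)]
  -- `N_d` is finite (core-rank count at the level `d`)
  haveI hNfin : Finite (inv.dualSelmerStructure ρ (D.atLevel 𝓕 d)).selmerGroup := by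
    haveI := CoreRankZero.finite_selmerGroup_atLevel D 𝓕 hfin d
    have h := CoreRankOne.natCard_selmerGroup_atLevel_eq_mul hperf hsum hcompl hM hS h𝓕 hfin hfind hχM hPS
      hU hTr hd
    refine Nat.finite_of_card_ne_zero fun h0 => ?_
    have h' : Nat.card (D.atLevel 𝓕 d).selmerGroup = 0 := by rw [h, h0, mul_zero]
    exact Nat.card_pos.ne' h'
  have hκsys : D.IsKolyvaginSystem 𝓕 κ.1 := (KolyvaginDatum.mem_kolyvaginSystems_iff D 𝓕 κ.1).mp κ.2
  have h3κ : 3 • κ.1 d = 0 := galoisCohomology.nsmul_eq_zero_of_forall ρ hM (κ.1 d)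
  by_cases hbot : (inv.dualSelmerStructure ρ (D.atLevel 𝓕 d)).selmerGroup = ⊥
  · -- `d` is a core vertex: a generator is non-zero and `κ ↦ κ_d` is injective, so `κ_d ≠ 0`
    have hκ0 : κ ≠ 0 := by
      obtain ⟨e⟩ := main.1
      haveI : Fact (1 < 3) := ⟨by norm_num⟩
      haveI : Nontrivial (D.kolyvaginSystems 𝓕) := e.symm.injective.nontrivial
      rintro rfl
      rw [AddSubgroup.zmultiples_zero_eq_bot] at hgen
      exact bot_ne_top hgen
    have hκd : κ.1 d ≠ 0 := by
      intro h0
      refine hκ0 ((main.2 d hd hbot).1 (Subtype.ext ?_))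
      simpa using h0
    have hord : addOrderOf (κ.1 d) = 3 := addOrderOf_eq_prime h3κ hκd
    rw [hbot, AddSubgroup.card_bot, hord]
    exact ⟨fun _ => rfl, fun h => absurd h (by norm_num)⟩
  · -- `d` is not a core vertex: `κ_d = 0` by stub vanishing at `m = 1` (row K6)
    have hκd : κ.1 d = 0 := by
      by_contra hne
      exact hbot (dualSelmerGroup_atLevel_eq_bot_of_apply_ne_zero_of_selfDual hperf hsum hcompl hM hS h𝓕
        hfin hfind hPS hadm hTr hUT (incl.comp (θ'.comp (tateDualComap incl))) hΘ'inj hch3 hκsys hd hne)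
    refine ⟨fun hdvd => ?_, fun _ => hκd⟩
    have hne1 : Nat.card (inv.dualSelmerStructure ρ (D.atLevel 𝓕 d)).selmerGroup ≠ 1 :=
      fun h1 => hbot (AddSubgroup.card_eq_one.mp h1)
    have h3 : Nat.card (inv.dualSelmerStructure ρ (D.atLevel 𝓕 d)).selmerGroup = 3 :=
      ((Nat.dvd_prime Nat.prime_three).mp hdvd).resolve_left hne1
    rw [hκd, addOrderOf_zero, h3]

end Summit.BirchSwinnertonDyer.Rank1Residual.GaloisImage

end
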